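import Summits.BirchSwinnertonDyer.BirchSwinnertonDyer.Theorems.SylvesterTwoHeegnerIndexCoupledUpperBoundReductionSeven
import Summits.BirchSwinnertonDyer.BirchSwinnertonDyer.Theorems.SylvesterTwoHeegnerIndexThmCOfTwoIntegral
import Summits.BirchSwinnertonDyer.BirchSwinnertonDyer.Theorems.SylvesterTwoHeegnerIndexLowerSplit
import Summits.BirchSwinnertonDyer.BirchSwinnertonDyer.Theorems.CMRungInputs
import HarnessLib

/-!
# Route `SylvesterTwoHeegnerIndex` (rung K7t): the hand item 19229 is EXACTLY «K3 typed ∧ K3* typed»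
# modulo `PublishedFactsTwo`; THEOREM C (crux 19802) is DOWNSTREAM of K3* typed — composition only

Cell `bsd-cm`, seat `bsd-cm-k7t-c2` (prover-bsd-cm-k7t-c2-g17-0; D-0074 hand «find: 19229»). PARTITION
(D-0054): CornerF at `p = 2` (B14/O12) × 𝒞_HSY (`E_p : x³ + y³ = p`, `p ≡ 4, 7 (9)`, `3 ∉ 𝔽_p^{×3}`)
× `p = 2` — states-the-residual-of, SHARPER than `SylvesterTwoHandItemResiduals` (p578406): closes no
cell and no item; moves no label; BSD is not claimed for any curve. Kernel record
`--supports stmt-BirchSwinnertonDyer-19229` (CONDITIONAL theorems; the gate records `proof.conditional`).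

WHAT THIS FILE RECORDS (all by composing LANDED glue; no new mathematics).

* `heegnerIndexUpperAtTwoHSY_iff_coupledUpperBounds` — **granted the route's support item
  `PublishedFactsTwo` (19231) ALONE, the fact-free UPPER hand item 19229 `HeegnerIndexUpperAtTwoHSY` is
  EQUIVALENT to the conjunction of the two typed conclusions of VARIANT J's stubs,
  `CoupledUpperBoundAtTwoFourModNine ∧ CoupledUpperBoundAtTwoSevenModNine` (THEOREM K3 / K3* typed,
  p563747 / p566195).**  So the two registered stubs (K3-4)/(K3-7) of crux 19804 are NECESSARY AND
  SUFFICIENT for the hand item modulo the published facts — the line loses nothing and needs nothing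
  else.  Inputs: k7t-c2's content disclosure `heegnerIndexUpperAtTwoHSY_iff_missingUpperBoundAt`
  (p418375) and pair form `missingUpperBoundAt_iff_pairBound` (UpperPairForm), which need only the
  `PublishedFactsTwo` conjuncts (Hu–Shu–Yin Thm 1.4, the CM rank-`0` triple, modularity, Gross–Zagier,
  Kolyvagin, GZK, Waldspurger, parity, Heegner points) — NOT the Hu–Shu–Yin height display
  (`PublishedFactsTwoPlus`'s extra conjunct) and NOT THEOREM C.
* `hsyPointTwoDivisibleSevenModNine_of_heightDisplay_of_coupledUpperBoundSeven` — **crux 19802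
  (THEOREM C typed, `HSYPointTwoDivisibleSevenModNine`) FOLLOWS from K3\* typed granted the printed
  height display** (`pairProductTwoIntegral_of_coupledUpperBoundSeven`: the coupled inequality has a
  non-negative left side, so it carries the `2`-integrality of `#Ш_an(E_p)·#Ш_an(E_{3p²})` on
  `p ≡ 7 (9)`; then two's `hsyPointTwoDivisibleSevenModNine_of_heightDisplay_of_twoIntegral`, p464849).
  So in VARIANT J the open crux 19802 is NOT an independent residual of the rung: any closure of stub
  (K3-7) closes it by this ten-line composition.  (On PAPER the dependence runs the other way — K3\*'s
  proof USES THEOREM C's identity (★), memo two §67 (W2-b); that provenance lives inside stub (K3-7) and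
  is unchanged.  Nothing here says THEOREM C is easier or harder than K3\*.)
* `heegnerIndexUpperAtTwoHSYOfFactsPlus_of_coupledUpperBounds` — the facts-plus parent 19725 from K3 +
  K3\* typed ALONE (p578406 routed it through THEOREM C and the closed 19803/19805; not needed).
* `cmAtTwo_of_facts_of_coupledUpperBounds_of_lowerParts` — **the rung leaf `X12.CMAtTwo` BY NAME from
  `PublishedFactsTwo` + K3 typed + K3\* typed + `LowerOnV0HSY` (19891) + `LowerOffV0HSY` (19892)**:
  FIVE named hypotheses where the residual of record (p578406 `cmAtTwo_of_residuals`, planner D331) has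
  SIX and the stronger binder `PublishedFactsTwoPlus` — THEOREM C and the height display are struck.

HONEST READING. Reformulation by composition; nothing is decided for any `p`; B14 = O12 stays OPEN AS A
CLASS; K3 is a paper theorem (refereed g61), K3\* a paper candidate (desk (M-K3-7)), both kernel-OPEN
(Euler-system layer, XL, uncommissioned); the lower residuals are the main-conjecture direction at the
inert prime `2`.  «find: 19229»: NOT FOUND as a kernel theorem (17th gen) — but its kernel residual is
now exactly two displayed `Prop`s and an `iff`.

References: Hu–Shu–Yin, JLMS 100 (2019) Thm. 1.3/1.4, Cor. 4.4, display (bsd) p. 12; Gross–Zagier (1986)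
I.6.5; Kolyvagin (1990) Thm. A; McCallum, LMS LN 153 (1991) §5 Thm. 5.4; cell memos as cited in the
imported files.
-/

set_option autoImplicit false
set_option linter.dupNamespace false

namespace Summit.BirchSwinnertonDyer.BirchSwinnertonDyer.Theorems.SylvesterTwoResidualsSharp

open WeierstrassCurve Literature.NumberTheory.EllipticCurves
  Literature.NumberTheory.EllipticCurves.HuShuYin2019
open Summit.BirchSwinnertonDyer.Rank1Residual
open Summit.BirchSwinnertonDyer.BirchSwinnertonDyer.Theses.SylvesterTwoHeegnerIndex
open Summit.BirchSwinnertonDyer.BirchSwinnertonDyer.Theorems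
open Summit.BirchSwinnertonDyer.BirchSwinnertonDyer.Theorems.SylvesterTwoCoupledUpperBound
open Literature.NumberTheory.EllipticCurves.Rank1Residual.Typed

/-! ## §1 The hand item 19229 ⟺ K3 typed ∧ K3\* typed, granted `PublishedFactsTwo` -/

/-- **Both typed coupled bounds ⇒ the upper half `MissingUpperBoundAt B 2` for EVERY member**, granted
only Hu–Shu–Yin Thm 1.4, the CM rank-`0` triple and modularity (the three conjuncts the pair form
uses; K3R-7's `missingUpperBoundAt_two_of_coupledUpperBounds` is the same statement under the stronger
binder `PublishedFactsTwoPlus`). [cite: HuShuYin2019, Cor. 4.4 and (bsd) p. 12] [cite: Miller2011LMS, Def. 1.1] -/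
theorem missingUpperBoundAt_two_of_three_facts_of_coupledUpperBounds (hHSY : thm14_threePart_product)
    (hCM0 : bsdTriple_of_hasCM_of_L_one_ne_zero) (hmod : hasEntireLFunction_rat)
    (hK4 : CoupledUpperBoundAtTwoFourModNine) (hK7 : CoupledUpperBoundAtTwoSevenModNine)
    {p : ℕ} (hp : p.Prime) (h9 : p % 9 = 4 ∨ p % 9 = 7) (h3 : ¬ ∃ x : ZMod p, x ^ 3 = 3)
    (B : WeierstrassCurve ℚ) [B.IsElliptic] [B.IsGloballyMinimal]
    (hB : ∃ C : VariableChange ℚ, C • B = cubeSumCurve (p : ℚ)) : MissingUpperBoundAt B 2 := by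
  have hn : (3 * (p : ℚ) ^ 2) ≠ 0 :=
    mul_ne_zero (by norm_num) (pow_ne_zero _ (Nat.cast_ne_zero.mpr hp.ne_zero))
  haveI := X12.CubeSumFamilies.isElliptic_cubeSumCurve hn
  obtain ⟨A, _, _, CA, hCA⟩ :=
    X12.CubeSumFamilies.exists_isGloballyMinimal_model (cubeSumCurve (3 * (p : ℚ) ^ 2))
  refine (SylvesterTwoUpper.missingUpperBoundAt_iff_pairBound hHSY hCM0 hmod hp h9 h3 A B hB
    ⟨CA, hCA⟩).mpr ?_
  rcases h9 with h4 | h7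
  · exact hK4 p hp h4 h3 A B hB ⟨CA, hCA⟩
  · exact hK7 p hp h7 h3 A B hB ⟨CA, hCA⟩

/-- **THE HAND ITEM 19229 `HeegnerIndexUpperAtTwoHSY` BY NAME ⟸ `PublishedFactsTwo` + K3 typed + K3\*
typed** — no THEOREM C, no height display. CONDITIONAL; credits nothing; both typed bounds are OPEN in
the kernel. [cite: HuShuYin2019, Cor. 4.4 and (bsd) p. 12] [cite: Kolyvagin1990, Thm. A]
[cite: McCallumLMS1991, Thm. 5.4] -/
theorem heegnerIndexUpperAtTwoHSY_of_facts_of_coupledUpperBounds (hF : PublishedFactsTwo)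
    (hK4 : CoupledUpperBoundAtTwoFourModNine) (hK7 : CoupledUpperBoundAtTwoSevenModNine) :
    HeegnerIndexUpperAtTwoHSY := by
  have hF' := hF
  unfold PublishedFactsTwo at hF'
  obtain ⟨hHSY, hBF, hmod, -, -, hGZ, hKo, hGZK, -, -, -⟩ := hF'
  exact SylvesterTwoUpper.heegnerIndexUpperAtTwoHSY_of_missingUpperBoundAt hGZ hKo hGZK hmod hBF
    (fun p hp h9 h3 B _ _ hB =>
      missingUpperBoundAt_two_of_three_facts_of_coupledUpperBounds hHSY hBF hmod hK4 hK7 hp h9 h3 B hB)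

/-- **Conversely, the hand item 19229 ⇒ K3 typed**, granted `PublishedFactsTwo` (content disclosure
p418375 + the pair form read forwards). [cite: HuShuYin2019, Cor. 4.4 and (bsd) p. 12]
[cite: Miller2011LMS, Def. 1.1] -/
theorem coupledUpperBoundFour_of_facts_of_heegnerIndexUpperAtTwoHSY (hF : PublishedFactsTwo)
    (hup : HeegnerIndexUpperAtTwoHSY) : CoupledUpperBoundAtTwoFourModNine := by
  have hF' := hF
  unfold PublishedFactsTwo at hF'
  obtain ⟨hHSY, hBF, hmod, -⟩ := hF'
  intro p hp h4 h3 A B _ _ _ _ hB hA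
  exact (SylvesterTwoUpper.missingUpperBoundAt_iff_pairBound hHSY hBF hmod hp (Or.inl h4) h3 A B hB
    hA).mp ((SylvesterTwoUpper.heegnerIndexUpperAtTwoHSY_iff_missingUpperBoundAt hF).mp hup p hp
      (Or.inl h4) h3 B hB)

/-- **Conversely, the hand item 19229 ⇒ K3\* typed**, granted `PublishedFactsTwo`.
[cite: HuShuYin2019, Cor. 4.4 and (bsd) p. 12] [cite: Miller2011LMS, Def. 1.1] -/
theorem coupledUpperBoundSeven_of_facts_of_heegnerIndexUpperAtTwoHSY (hF : PublishedFactsTwo)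
    (hup : HeegnerIndexUpperAtTwoHSY) : CoupledUpperBoundAtTwoSevenModNine := by
  have hF' := hF
  unfold PublishedFactsTwo at hF'
  obtain ⟨hHSY, hBF, hmod, -⟩ := hF'
  intro p hp h7 h3 A B _ _ _ _ hB hA
  exact (SylvesterTwoUpper.missingUpperBoundAt_iff_pairBound hHSY hBF hmod hp (Or.inr h7) h3 A B hB
    hA).mp ((SylvesterTwoUpper.heegnerIndexUpperAtTwoHSY_iff_missingUpperBoundAt hF).mp hup p hp
      (Or.inr h7) h3 B hB)

/-- **«find: 19229» AS AN EQUIVALENCE: granted `PublishedFactsTwo` (item 19231) alone,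
`HeegnerIndexUpperAtTwoHSY ↔ CoupledUpperBoundAtTwoFourModNine ∧ CoupledUpperBoundAtTwoSevenModNine`.**
VARIANT J's two stubs are necessary and sufficient for the hand item modulo the published facts; the
kernel residual of 19229 is exactly these two displayed `Prop`s (THEOREM K3 typed — paper, refereed;
THEOREM K3\* typed — paper candidate). OPEN AS A CLASS. [cite: HuShuYin2019, Cor. 4.4 and (bsd) p. 12]
[cite: Kolyvagin1990, Thm. A] [cite: McCallumLMS1991, Thm. 5.4] -/
theorem heegnerIndexUpperAtTwoHSY_iff_coupledUpperBounds (hF : PublishedFactsTwo) :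
    HeegnerIndexUpperAtTwoHSY ↔
      (CoupledUpperBoundAtTwoFourModNine ∧ CoupledUpperBoundAtTwoSevenModNine) :=
  ⟨fun hup => ⟨coupledUpperBoundFour_of_facts_of_heegnerIndexUpperAtTwoHSY hF hup,
      coupledUpperBoundSeven_of_facts_of_heegnerIndexUpperAtTwoHSY hF hup⟩,
    fun h => heegnerIndexUpperAtTwoHSY_of_facts_of_coupledUpperBounds hF h.1 h.2⟩

/-- The facts-conditional twin 19476 `HeegnerIndexUpperAtTwoHSYOfFacts` from K3 + K3\* typed alone
(its antecedent is `PublishedFactsTwo`'s body verbatim). [cite: HuShuYin2019, Cor. 4.4 and (bsd) p. 12] -/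
theorem heegnerIndexUpperAtTwoHSYOfFacts_of_coupledUpperBounds
    (hK4 : CoupledUpperBoundAtTwoFourModNine) (hK7 : CoupledUpperBoundAtTwoSevenModNine) :
    HeegnerIndexUpperAtTwoHSYOfFacts :=
  fun hF => heegnerIndexUpperAtTwoHSY_of_facts_of_coupledUpperBounds hF hK4 hK7

/-- The facts-plus parent 19725 `HeegnerIndexUpperAtTwoHSYOfFactsPlus` from K3 + K3\* typed ALONE — the
glue route 19805 ∘ 19803 (which displays THEOREM C) is not needed; only the `PublishedFactsTwo` part of
the binder is used. [cite: HuShuYin2019, Cor. 4.4 and (bsd) p. 12] [cite: McCallumLMS1991, Thm. 5.4] -/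
theorem heegnerIndexUpperAtTwoHSYOfFactsPlus_of_coupledUpperBounds
    (hK4 : CoupledUpperBoundAtTwoFourModNine) (hK7 : CoupledUpperBoundAtTwoSevenModNine) :
    HeegnerIndexUpperAtTwoHSYOfFactsPlus :=
  fun hFP => heegnerIndexUpperAtTwoHSY_of_facts_of_coupledUpperBounds hFP.1 hK4 hK7

/-! ## §2 THEOREM C (crux 19802) is downstream of K3\* typed -/

/-- **K3\* typed ⇒ the `2`-INTEGRALITY of the pair product on `p ≡ 7 (9)`** (fact-free): the coupled
inequality `ord₂ #Ш(B)[2^∞] + ord₂ #Ш(A)[2^∞] ≤ ord₂ (qB·qA)` has a non-negative left side, and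
`#Ш_an` is single-valued. [cite: HuShuYin2019, display (bsd) p. 12] -/
theorem pairProductTwoIntegral_of_coupledUpperBoundSeven (hK7 : CoupledUpperBoundAtTwoSevenModNine) :
    SylvesterTwoNonneg.PairProductTwoIntegralSevenModNine := by
  intro p hp h7 h3 A B _ _ _ _ hB hA qB qA hqB hqA
  obtain ⟨qB', qA', hqB', hqA', -, hle⟩ := hK7 p hp h7 h3 A B hB hA
  have eB : qB' = qB := by exact_mod_cast hqB'.symm.trans hqB
  have eA : qA' = qA := by exact_mod_cast hqA'.symm.trans hqA
  subst eB eA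
  have h0 : (0 : ℤ) ≤ (padicValNat 2 (Nat.card (AddCommGroup.primaryComponent B.sha 2)) : ℤ) +
      (padicValNat 2 (Nat.card (AddCommGroup.primaryComponent A.sha 2)) : ℤ) := by positivity
  exact h0.trans hle

/-- **THEOREM C typed (crux 19802 `HSYPointTwoDivisibleSevenModNine`) ⟸ the printed Hu–Shu–Yin height
display + K3\* typed**: in VARIANT J the open crux 19802 is a COROLLARY of stub (K3-7)'s conclusion
(two's `hsyPointTwoDivisibleSevenModNine_of_heightDisplay_of_twoIntegral`, p464849, after §2's
integrality). Provenance caveat: on paper K3\*'s proof uses THEOREM C's identity (★) (memo two §67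
(W2-b)); this says nothing about which is harder. [cite: HuShuYin2019, display (bsd) p. 12]
[cite: McCallumLMS1991, Thm. 5.4] -/
theorem hsyPointTwoDivisibleSevenModNine_of_heightDisplay_of_coupledUpperBoundSeven
    (hH : HuShuYin2019.shaAnPair_mul_height_eq_two_zpow_mul_height)
    (hK7 : CoupledUpperBoundAtTwoSevenModNine) : HSYPointTwoDivisibleSevenModNine :=
  SylvesterTwoNonneg.hsyPointTwoDivisibleSevenModNine_of_heightDisplay_of_twoIntegral hH
    (pairProductTwoIntegral_of_coupledUpperBoundSeven hK7)

/-- The same under the route's facts-plus binder (19724 `PublishedFactsTwoPlus`, whose second conjunct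
IS the height display): `PublishedFactsTwoPlus → CoupledUpperBoundAtTwoSevenModNine → (crux 19802)`.
[cite: HuShuYin2019, display (bsd) p. 12] -/
theorem hsyPointTwoDivisibleSevenModNine_of_factsPlus_of_coupledUpperBoundSeven
    (hFP : PublishedFactsTwoPlus) (hK7 : CoupledUpperBoundAtTwoSevenModNine) :
    HSYPointTwoDivisibleSevenModNine :=
  hsyPointTwoDivisibleSevenModNine_of_heightDisplay_of_coupledUpperBoundSeven hFP.2 hK7

/-! ## §3 The rung leaf from FIVE named residuals -/

/-- **THE RUNG LEAF `X12.CMAtTwo` (`BSD(E_p, 2)` on 𝒞_HSY) BY NAME ⟸ `PublishedFactsTwo` + THEOREM K3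
typed + THEOREM K3\* typed + `LowerOnV0HSY` (19891) + `LowerOffV0HSY` (19892)** — through the closed
glue 19893 (`SylvesterTwoLowerSplit.lowerOfFacts_of_onV0_of_offV0`) and the Theses-free bridge of the
closed Assembly 19232 (`CMRungInputs.cmAtTwo_of_inputs`). Sharper than the residual of record
`SylvesterTwoHandItemResiduals.cmAtTwo_of_residuals` (p578406): THEOREM C (19802) and the height display
(`PublishedFactsTwoPlus`) are NOT hypotheses. CONDITIONAL; nothing decided; BSD is not claimed.
[cite: GrossZagier1986, V.§2 (pp. 310–312)] [cite: HuShuYin2019, Thm. 1.4 (p. 3)]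
[cite: McCallumLMS1991, Thm. 5.4] -/
theorem cmAtTwo_of_facts_of_coupledUpperBounds_of_lowerParts (hF : PublishedFactsTwo)
    (hK4 : CoupledUpperBoundAtTwoFourModNine) (hK7 : CoupledUpperBoundAtTwoSevenModNine)
    (hon : LowerOnV0HSY) (hoff : LowerOffV0HSY) :
    _root_.Summit.BirchSwinnertonDyer.Rank1Residual.X12.CMAtTwo :=
  _root_.Summit.BirchSwinnertonDyer.BirchSwinnertonDyer.Rank1Residual.CMRungInputs.cmAtTwo_of_inputs
    (SylvesterTwoLowerSplit.lowerOfFacts_of_onV0_of_offV0 hon hoff hF)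
    (heegnerIndexUpperAtTwoHSY_of_facts_of_coupledUpperBounds hF hK4 hK7) hF

end Summit.BirchSwinnertonDyer.BirchSwinnertonDyer.Theorems.SylvesterTwoResidualsSharp
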